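import Summits.QuantumFields.QCD.Cruxes.InterleavedFlowProper.Lines.NearConstantFlux

/-!
# NearConstantFlux — floor witness (F3 / BC5), forward generator G1 `next-rung`, seed `g1-QuantumFields-16786`

The rung family `QuarkLoopNearConstantFlux δ₀` (defined in `Lines/NearConstantFlux.lean`, rung = member `1`)
specialises at `δ₀ = 0` to the proved floor
`Summit.QuantumFields.QCD.Theses.HeatSlicedQuarks.QuarkLoopCoefficient`, via the seed theorem
`Summit.QuantumFields.QCD.Cruxes.QuarkLoopCoefficient.Sketch.QuarkLoopCoefficient_of` BY NAME.  No stub, no sorry.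
(The same proof is kernel-checked inside the skeleton as `floor_specialises`; this file re-elaborates it for the tribunal.)
-/

namespace Summit.QuantumFields.QCD.Cruxes.InterleavedFlowProper.NearConstantFlux

/-- F3 witness: member `0` of the rung family is the floor (seed theorem by name). -/
example : QuarkLoopNearConstantFlux 0 := by
  obtain ⟨C, c, hc, H⟩ := Summit.QuantumFields.QCD.Cruxes.QuarkLoopCoefficient.Sketch.QuarkLoopCoefficient_of
  refine ⟨C, c, hc, ?_⟩
  intro δ hδ0 hδ1 L _ U θ η hη h1 h2 h3 t ht htL htθ x
  obtain rfl : δ = 0 := le_antisymm hδ1 hδ0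
  have hη0 : ∀ y, η y = 0 := fun y => abs_nonpos_iff.mp (hη y)
  simp only [hη0, Complex.ofReal_zero, add_zero] at h2 htθ
  simp only [hη0, add_zero, ne_eq, OfNat.ofNat_ne_zero, not_false_eq_true, zero_pow, mul_zero, zero_mul]
  exact H L U θ h1 h2 h3 t ht htL htθ x

/-- The same witness, by the skeleton's sorry-free theorem. -/
example : QuarkLoopNearConstantFlux 0 := floor_specialises

/-- Orientation: the family is monotone, so the floor sits below the rung `Rung = QuarkLoopNearConstantFlux 1`. -/
example (h : Rung) : QuarkLoopNearConstantFlux 0 :=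
  quarkLoopNearConstantFlux_mono (by norm_num) h

end Summit.QuantumFields.QCD.Cruxes.InterleavedFlowProper.NearConstantFlux
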